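import Summits.QuantumFields.BalabanUV.T4Continuum.Support.NE9LinSizeEnd
import Summits.QuantumFields.BalabanUV.T4Continuum.Support.NE9LinSizeKPMultiScale

/-!
# NE9LinSizeEndMultiScale — E5′-ms: the NE9 END face ON BAŁABAN'S MULTI-SCALE FAMILY OF DOMAINS (`NE9MultiScaleChart.msChart`,
every creation step on its own torus `T^{(k)}`) with EVERY geometry / entropy binder in print's d_k-currency — repair item NE9-F8
«d-currency dischargers», PART 2, STAGE B-iii = crew row (w13) part 2 of row NE9, multi-scale twin of E5′ (cell `pub-balaban`,
T4-DAG §2 node U3 / §6 NE9; unit `b2b-balaban-t4-ne9-formalise-leaf-10`, gen 3)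

HONEST FRAMING (T4-DAG PAGE 1).  Rung (B)+1 on a FIXED finite torus — NOT infinite volume, NOT a mass gap, NOT the Clay problem.
NE9 is a cell NEW ESTIMATE, NOT PRINTED, and is NOT discharged here; every analytic input stays a DISPLAYED binder ((A″) the
(2.38)-TYPE decay of the box majorant in `d_k`, uniformly over the admissible box — GAPS G-ne9p2-5; (L‴) the (2.20)-summand decay of
the coefficient tables; the recursion side); [I]/[II] are quoted for TYPES only (ABSOLUTE RULE); `FlowStep.BetaPertH`, (B), (B^μ)
do not occur.  HONEST DEPENDENCY (verbatim): continuum YM on T⁴ ⇐ BetaPertH ∧ nine spine estimates (0/9 proved); BetaPertH ⇐ (D1)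
∧ (D4) ∧ CAP+tail; G-an2-4 gates asym, D1 and NE2/3/4.

WHY.  E5′ (`NE9LinSizeEnd.torus_termSize_ne9_and_fadingMemory_of_linSizeDischargers`, gen 2 of this lineage) is the END face of
the P2 road with the Kotecký–Preiss clause, the extracted decay (2.27), the pin budget (2.40)–(2.41) AND the pinned sums (1.26) all
in Bałaban's linear size `d`, ADDITIVE rate condition, no `e^{a}`/`e^{a′}` (journal finding F-ne9leaf01-1 (R)(P) repaired) — but on a
SINGLE-SCALE cube chart over one torus `Fin ν → ZMod N`, with the d-currency comparability `κ·C.d X ≤ a″·d(cubes X)` displayed.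
Print's localization domains are MULTI-SCALE: `𝐃 = ⊔_k 𝐃_k`, the scale-`k` domains living on `T^{(k)}` ([I] p. 251), which road
P2 typed as ONE cube chart `NE9MultiScaleChart.msChart` on the sigma sites `Site ν n = Σ k, Fin ν → ZMod (n k)` with the scale-tagged
wall adjacency `SAdj` (F3), carriers `msCarriers` whose decay length IS `d_k` (`d_eq`, `rfl`).  Crew row (w13) part 4
(`NE9LinSizeKPMultiScale`, seat …-leaf-05-g2) transported the three weight binders of the trunk to `msChart` (KP clause,
`DecayExtract`, `PinBudget` with `κ ≤ a″` EXACTLY).  THIS FILE supplies the one remaining binder — the LIP side (1.26) on the sigma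
sites, by its own fibre transfer — and plugs everything into the weight-generic trunk `NE9WeightedClauseEnd` at `Γ := msChart …`:
the first END face of row NE9 on the multi-scale chart, and it is born in d_k-currency.

WHAT IS PROVED (kernel; `[folklore]` lattice bookkeeping + composition BY NAME; 0 `def`, 0 sorry, no END face re-wired).
§1 THE LIP SIDE ON THE SIGMA SITES.  `fst_eq_of_isConn_sAdj` — an `SAdj`-connected family has ONE scale tag;
   `pinnedSum_le_of_msLinSizeDecay` — weights `w Y ≤ αc·e^{−a·d(dom Y)}` (`d = msLinSize`, part 4's d_k read on the fibre), every
   nonempty domain `SAdj`-connected, the domain map injective on nonempty domains, `a ≥ 2^ν·log 2 + log(8ν)`: at every SITE `x`,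
   `Σ_{Y : x ∈ dom Y} w Y ≤ αc·2^(ν+1+2^ν)` (the domains through `x` live on the fibre `T^{(x.1)}`, project injectively to
   wall-connected families there, and `NE9LinSizeEntropy.sum_exp_neg_mul_linSize_le_const` applies — TYPE [II] (1.26) p. 8);
   `pin_of_msLinSizeDecay` — (L‴) in `d_k` ⇒ the pinned scale bound (L″), conclusion LITERALLY the `hpin` shape of
   `T4HistoryLipschitzSegment.coeffSum_le_of_pinned` at `α := Site ν n`.
§2 **E5′-ms `msChart_termSize_ne9_and_fadingMemory_of_linSizeDischargers`** — `TermSize E W κ Nsz ∧ NE9 E W κ (prodModuli ℓ fun _ =>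
   μ) ∧ FadingMemory (ℓ/μ) μ (…)` with E5′'s rate letter **`μ = ω + 4·lipbar·(a₁·e^{−a″(ν+1)})·τ̄` VERBATIM**, for functionals on
   `msCarriers`; binders = E5′'s with `hXconn`, `hcmp`/`hdle` GONE (wall-connectedness of a domain's cubes is built into
   `msCarriers`; the carriers' `d` IS `d_k`), the rate displayed as **`κ ≤ a″`** EXACTLY, the chart degree `D = 2ν` inside `hsmall`,
   (A″) `hdecayLin` and (L‴) `hlin` in `msLinSize`, `hdomconn` w.r.t. `SAdj`.  Composition BY NAME:
   `NE9WeightedClauseEnd.termSize_and_ne9_of_weightedClause (msChart …)` ∘ (`NE9LinSizeKPMultiScale.msChart_kpClause_of_linSizeDecay` ∘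
   `NE9LinSizeEnd.two_mul_one_add_card_mul_le`, `msChart_decayExtract_linSize`, `msChart_pinBudget_linSize`, §1 ∘ `coeffSum_le_of_pinned`).
§3 `…_fibre` — the same face accepting road P2's own (A″) binder shape on the multi-scale chart, `ε′ k·e^{−a′·fibreLinSize X.1 γ′}`
   (`NE9MultiScaleChart.boxMajorantDecay_of_linSizeDecay_ms`, F3 §4), VERBATIM (`msLinSize_eq` on the step volume).
DISGUISE TEST.  Every discharged binder is a ONE-history statement (configuration-free majorants, coefficient tables, lattice
geometry) at the occurring coupling; no second history, no coupling difference — not NE9 in disguise.  N2 on this face reads as on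
E5′ (F-ne9leaf10g2-1: «κ sufficiently large», uniformly in M; `NE9LinSizeEndBudget` applies letter for letter with `D = 2ν`).

References (TYPES only): [Balaban1988RG2Cluster] T. Bałaban, CMP 116 (1988) (1.26) p. 8, (1.36) p. 9, (2.11)–(2.13) p. 14,
(2.18)–(2.20) p. 16, (2.23)–(2.27) pp. 17–18, (2.29)–(2.30) p. 18, Lemma 3 (2.38) p. 20, (2.40)–(2.41) p. 21 and p. 21 text;
[Balaban1987RG1] CMP 109 (1987) p. 251, (0.23) p. 256, (0.26) p. 257, p. 257, (1.18) p. 263; [KoteckyPreiss1986] CMP 103 (1986) (1)–(3).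
-/

noncomputable section

namespace Summit.QuantumFields.BalabanUV.T4Continuum.NE9LinSizeEndMultiScale

open scoped BigOperators
open Metric Set MeasureTheory BoundedContinuousFunction
open Literature.Probability.LatticeModels
open Literature.MathematicalPhysics.QuantumFieldTheory
open Literature.MathematicalPhysics.QuantumFieldTheory.Balaban1983to89
open Literature.MathematicalPhysics.QuantumFieldTheory.Balaban1983to89.T4OutputRate
open Literature.MathematicalPhysics.QuantumFieldTheory.Balaban1983to89.T4ActivityLipschitz
open Literature.MathematicalPhysics.QuantumFieldTheory.Balaban1983to89.T4HistoryLipschitzRecursion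
open Literature.MathematicalPhysics.QuantumFieldTheory.Balaban1983to89.T4HistoryLipschitzOuter
open Literature.MathematicalPhysics.QuantumFieldTheory.Balaban1983to89.T4HistoryLipschitzActivity
open Literature.MathematicalPhysics.QuantumFieldTheory.Balaban1983to89.T4HistoryLipschitzEntropy
open Literature.MathematicalPhysics.QuantumFieldTheory.Balaban1983to89.T4HistoryLipschitzCubeGeometry
open Literature.MathematicalPhysics.QuantumFieldTheory.Balaban1983to89.T4HistoryLipschitzActivity (ClusterGeom)
open Literature.MathematicalPhysics.QuantumFieldTheory.Balaban1983to89.T4HistoryLipschitzSegment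
open Literature.MathematicalPhysics.QuantumFieldTheory.Balaban1983to89.T4HistoryLipschitzLinearSize
open Summit.QuantumFields.BalabanUV.T4Continuum.NE9MultiScaleChart
open Summit.QuantumFields.BalabanUV.T4Continuum.NE9LinSizeEntropy
open Summit.QuantumFields.BalabanUV.T4Continuum.NE9LinSizeKP
open Summit.QuantumFields.BalabanUV.T4Continuum.NE9LinSizeKPMultiScale
open Summit.QuantumFields.BalabanUV.T4Continuum.NE9WeightedClauseEnd
open Summit.QuantumFields.BalabanUV.T4Continuum.NE9LinSizeEnd

/-! ## §1 The lip side on the sigma sites: the pinned sums (1.26) in d_k, κ-free constant, additive threshold -/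

section Scale

variable {ν : ℕ} {n : ℕ → ℕ}

/-- **AN `SAdj`-CONNECTED FAMILY HAS ONE SCALE TAG**: every site of a family connected (rooted reachability) for the scale-tagged
wall adjacency has the scale of the root — each `SAdj` step keeps the tag. [folklore] -/
theorem fst_eq_of_isConn_sAdj {S : Finset (Site ν n)} {a : Site ν n} (h : Polymer.IsConn (SAdj ν n) S a) :
    ∀ b ∈ S, b.1 = a.1 := by
  intro b hb
  have hr := (Polymer.isConn_iff_reflTransGen.1 h).2 b hb
  clear hb
  induction hr with
  | refl => rfl
  | tail _ hbc ih => exact hbc.1.1.symm.trans ih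

end Scale

section Pinned

variable {ν : ℕ} {n : ℕ → ℕ} [∀ k, NeZero (n k)] {F : Type*} [Fintype F]

/-- **THE PINNED SUM (1.26) ON THE MULTI-SCALE SITES FROM DECAY IN d_k (kernel).**  Weights `w Y ≤ αc·e^{−a·d(dom Y)}` indexed by a
finite type, `d = msLinSize` (the lattice-edge linear size read on the fibre of the domain's scale, `NE9LinSizeKPMultiScale.msLinSize_eq`),
every NONEMPTY domain connected for the scale-tagged wall adjacency `SAdj` ([I] p. 257 «two consecutive cubes have a common wall»,
on the torus `T^{(k)}` of the domain's creation step, p. 251), the domain map INJECTIVE on the nonempty domains, and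
`a ≥ 2^ν·log 2 + log(8ν)`: at every site `x`, `Σ_{Y : x ∈ dom Y} w Y ≤ αc·2^(ν+1+2^ν)` — the TYPE of [II] (1.26) p. 8
«Σ_{X∈𝐃_j, X⊃□′} exp(−κd_j(X)) ≤ O(1), (1.26) for κ sufficiently large», NO prefactor `e^{a}`.  Proof: a domain through `x` has the
single scale `x.1` (`fst_eq_of_isConn_sAdj`), so it is recovered from its projection to the fibre `T^{(x.1)}`
(`eq_of_image_fibreProj_eq`), which is wall-connected (`isConn_image_fibreProj`) hence has a lattice skeleton; then
`NE9LinSizeEntropy.sum_exp_neg_mul_linSize_le_const` on that fibre — the single-scale lemma `NE9LinSizePinned.pinnedSum_le_of_linSizeDecay`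
transported, not re-proved. [cite: Balaban1988RG2Cluster, (1.26) p.8; Balaban1987RG1, p.251, (0.26) p.257 and p.257] -/
theorem pinnedSum_le_of_msLinSizeDecay {w : F → ℝ} {dom : F → Finset (Site ν n)} {αc a : ℝ} (hαc : 0 ≤ αc)
    (ha : (2:ℝ) ^ ν * Real.log 2 + Real.log (8 * ν) ≤ a)
    (hw : ∀ Y, w Y ≤ αc * Real.exp (-(a * (msLinSize (n := n) (dom Y) : ℝ))))
    (hconn : ∀ Y, (dom Y).Nonempty → ∃ b ∈ dom Y, Polymer.IsConn (SAdj ν n) (dom Y) b)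
    (hinj : Set.InjOn dom {Y | (dom Y).Nonempty}) (x : Site ν n) :
    ∑ Y ∈ Finset.univ.filter (fun Y => x ∈ dom Y), w Y ≤ αc * 2 ^ (ν + 1 + 2 ^ ν) := by
  classical
  -- every domain through `x` is a one-scale family of scale `x.1`
  have hS : ∀ Y, x ∈ dom Y → ∀ b ∈ dom Y, b.1 = x.1 := by
    intro Y hxY b hb
    obtain ⟨r, -, hc⟩ := hconn Y ⟨x, hxY⟩
    exact (fst_eq_of_isConn_sAdj hc b hb).trans (fst_eq_of_isConn_sAdj hc x hxY).symm
  -- (1.26) on the fibre `T^{(x.1)}` (part 1a BY NAME), multiplied by `αc`; its summation range is NOT restated here (the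
  -- lemma's own `Finset.filter` instance is kept, so that no `Fintype`-based decidability of `∃ S, IsSkeleton X S` creeps in)
  have key := mul_le_mul_of_nonneg_left (sum_exp_neg_mul_linSize_le_const
    ((Finset.univ.biUnion dom).image (fibreProj (n := n) x.1)) (fibreProj (n := n) x.1 x) ha) hαc
  rw [Finset.mul_sum] at key
  refine le_trans ?_ key
  -- read the weights on the fibre and re-index the sum by the projected domains (injective: one scale + `hinj`)
  have h1 : ∑ Y ∈ Finset.univ.filter (fun Y => x ∈ dom Y), w Y ≤
      ∑ Y ∈ Finset.univ.filter (fun Y => x ∈ dom Y),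
        αc * Real.exp (-(a * (linSize ((dom Y).image (fibreProj (n := n) x.1)) : ℝ))) := by
    refine Finset.sum_le_sum fun Y hY => ?_
    have hxY : x ∈ dom Y := (Finset.mem_filter.1 hY).2
    have hwY := hw Y
    rwa [msLinSize_eq (hS Y hxY) ⟨x, hxY⟩] at hwY
  have h2 : ∑ Y ∈ Finset.univ.filter (fun Y => x ∈ dom Y),
        αc * Real.exp (-(a * (linSize ((dom Y).image (fibreProj (n := n) x.1)) : ℝ))) =
      ∑ X ∈ (Finset.univ.filter (fun Y => x ∈ dom Y)).image (fun Y => (dom Y).image (fibreProj (n := n) x.1)),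
        αc * Real.exp (-(a * (linSize X : ℝ))) := by
    rw [Finset.sum_image]
    intro Y₁ h₁ Y₂ h₂ he
    have hx₁ : x ∈ dom Y₁ := (Finset.mem_filter.1 h₁).2
    have hx₂ : x ∈ dom Y₂ := (Finset.mem_filter.1 h₂).2
    exact hinj ⟨x, hx₁⟩ ⟨x, hx₂⟩ (eq_of_image_fibreProj_eq (hS Y₁ hx₁) (hS Y₂ hx₂) he)
  refine h1.trans (h2.le.trans (Finset.sum_le_sum_of_subset_of_nonneg ?_ fun X _ _ => mul_nonneg hαc (Real.exp_nonneg _)))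
  -- the projected domains through `x` are wall-connected families of the fibre containing `fibreProj x.1 x`: skeletons
  intro X hX
  obtain ⟨Y, hY, rfl⟩ := Finset.mem_image.1 hX
  have hxY : x ∈ dom Y := (Finset.mem_filter.1 hY).2
  obtain ⟨r, -, hc⟩ := hconn Y ⟨x, hxY⟩
  -- (`(_)`: the filter's decidability instance is taken from part 1a's statement by unification, not re-synthesized)
  exact (@Finset.mem_filter _ _ (_) _ _).2 ⟨Finset.mem_powerset.2
    (Finset.image_subset_image (Finset.subset_biUnion_of_mem dom (Finset.mem_univ Y))),
    Finset.mem_image_of_mem _ hxY, _, isSkeleton_self_of_isConn (isConn_image_fibreProj (hS Y hxY) hc)⟩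

variable {Bg : Type} {Ω : Type*}

/-- **(L‴) IN d_k ON THE MULTI-SCALE SITES ⇒ (L″) WITHOUT `e^{a}` (kernel).**  PER-DOMAIN DECAY of the coefficient tables
`‖c_ω(Y)‖ ≤ αc k·e^{−a·d(dom Y)}` with `d = msLinSize` (TYPE: the (2.20) summand «+ Σ_{Y∈𝐃} α₄exp(−δκd_k(Y))» of [II] p. 16 = radius
(2.18) × table size (1.36), `a ↔ δκ`, the domains `Y ∈ 𝐃 = ⊔_k 𝐃_k` on their own tori), `SAdj`-connectedness of every nonempty
domain ([I] p. 257), injectivity of the domain labelling on nonempty domains, the ADDITIVE threshold `a ≥ 2^ν·log 2 + log(8ν)` and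
`αc k·2^(ν+1+2^ν) ≤ lip k` GIVE the pinned scale bound (L″) — LITERALLY the `hpin` hypothesis of
`T4HistoryLipschitzSegment.coeffSum_le_of_pinned` / `cubeChart_ne9_and_fadingMemory_of_pinned` at `α := Site ν n`.  Single-scale
twin: `NE9LinSizePinned.pin_of_linSizeDecay`.  (L‴) is displayed, not asserted.
[cite: Balaban1988RG2Cluster, (2.18)-(2.20) p.16, (1.36) p.9, (1.26) p.8; Balaban1987RG1, p.251 and p.257] -/
theorem pin_of_msLinSizeDecay {c : ℕ → ℝ → Bg → Finset (Site ν n) → Ω → F → ℂ}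
    {dom : ℕ → Finset (Site ν n) → F → Finset (Site ν n)} {αc lip : ℕ → ℝ} {a : ℝ} (hαc : ∀ k, 0 ≤ αc k)
    (ha : (2:ℝ) ^ ν * Real.log 2 + Real.log (8 * ν) ≤ a) (hliplb : ∀ k, αc k * 2 ^ (ν + 1 + 2 ^ ν) ≤ lip k)
    (hlin : ∀ k s U (γ : Finset (Site ν n)) ω Y,
      ‖c k s U γ ω Y‖ ≤ αc k * Real.exp (-(a * (msLinSize (n := n) (dom k γ Y) : ℝ))))
    (hdomconn : ∀ k (γ : Finset (Site ν n)) Y, (dom k γ Y).Nonempty →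
      ∃ b ∈ dom k γ Y, Polymer.IsConn (SAdj ν n) (dom k γ Y) b)
    (hdominj : ∀ k (γ : Finset (Site ν n)), Set.InjOn (dom k γ) {Y | (dom k γ Y).Nonempty}) :
    ∀ k s U (γ : Finset (Site ν n)) ω, ∀ x ∈ γ,
      ∑ Y ∈ Finset.univ.filter (fun Y => x ∈ dom k γ Y), ‖c k s U γ ω Y‖ ≤ lip k :=
  fun k s U γ ω x _ =>
    (pinnedSum_le_of_msLinSizeDecay (hαc k) ha (hlin k s U γ ω) (hdomconn k γ) (hdominj k γ) x).trans (hliplb k)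

end Pinned

/-! ## §2 E5′-ms: the END face on the multi-scale chart with every geometry / entropy binder in d_k-currency -/

section Chart

variable (ν : ℕ) (n : ℕ → ℕ) [∀ k, NeZero (n k)]
variable (BgA BgB : Type) (gauge : BgA → BgA → ℝ) (gauge_nonneg : ∀ U U', 0 ≤ gauge U U') (transport : BgB → BgA)
variable {Bg : Type} {Sp : Type*} [TopologicalSpace Sp] [MeasurableSpace Sp] [OpensMeasurableSpace Sp] {F : Type*}
  [Fintype F] {Ω : Type*} [MeasurableSpace Ω]

/-- **E5′-ms — THE SIZE BOUND, NE9 ∧ FADING MEMORY ON THE MULTI-SCALE CHART WITH EVERY GEOMETRY / ENTROPY BINDER IN BAŁABAN'S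
d_k-CURRENCY (kernel end-to-end).**  The END of the P2 road for functionals on the multi-scale carriers `msCarriers` (domain indices =
(creation step `k`, a wall-connected cube family of `T^{(k)}`), `d = d_k`, [I] pp. 251, 257) over the chart `msChart` (F3), with —
compared with the single-scale E5′ (`NE9LinSizeEnd.torus_termSize_ne9_and_fadingMemory_of_linSizeDischargers`) — the SAME displayed
binders except: `hXconn` GONE (built into the carriers), the comparability `hcmp`/`hdle` GONE and the rate displayed as **`hκa : κ ≤ a″`**
EXACTLY (the carriers' decay length IS `d_k`, `NE9MultiScaleChart.d_eq`), the chart degree `2ν` in the smallness, and the two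
activity-side decays read in `msLinSize` (d_k on the fibre of the polymer's scale): (lip) `ha : 2^ν·log 2 + log(8ν) ≤ a`,
`hliplb : α₄(k)·2^(ν+1+2^ν) ≤ lip k`, (L‴) `hlin`, `hdomconn` (w.r.t. `SAdj`), `hdominj` ((1.26) in `d_k`, §1); (KP) the ADDITIVE rate
condition `hrate : 2^ν·log 2 + log(8ν) ≤ a′ − a″ − 2^ν·(a₁ + log 2)` and `hsmall : (2ν+1)·(2ε′ k)·e^{a″(ν+1)+2^ν(a₁+log 2)}·2^(ν+1+2^ν)
≤ a₁` (part 4 §3, prefactor slot `a₀ = log 2`); (A″) `hdecayLin` in `d_k` (TYPE (2.38)); (N) `p₀ j + a₁·e^{−a″(ν+1)} ≤ N (j+1)`.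
Conclusion: `TermSize E W κ N` and the END with rate letter **`μ = ω + 4·lipbar·(a₁·e^{−a″(ν+1)})·τ̄`** — E5′'s, token for token.
Composition BY NAME: `NE9WeightedClauseEnd.termSize_and_ne9_of_weightedClause (msChart …)` at `a = sizeWeight a₁`,
`d γ = a″·(d(γ) + (ν+1))`, `δ X = a″·(d_k(X) + (ν+1))`, `B = a₁·e^{−a″(ν+1)}` ∘ (`msChart_kpClause_of_linSizeDecay` ∘
`two_mul_one_add_card_mul_le`, `msChart_decayExtract_linSize` (= (2.27)), `msChart_pinBudget_linSize`, `pin_of_msLinSizeDecay` ∘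
`coeffSum_le_of_pinned`).  (A″)/(L‴)/the recursion side DISPLAYED, nothing of [I]–[III] asserted; rung (B)+1 bookkeeping on a finite
torus. [cite: Balaban1988RG2Cluster, (1.26) p.8, (1.36) p.9, (2.11)-(2.13) p.14, (2.18)-(2.20) p.16, (2.26)-(2.27) pp.17-18, (2.30) p.18, Lemma 3 (2.38) p.20, (2.40)-(2.41) p.21 and p.21 text; Balaban1987RG1, p.251, (0.23) p.256, p.257, (1.18) p.263; KoteckyPreiss1986, (1)-(3)] -/
theorem msChart_termSize_ne9_and_fadingMemory_of_linSizeDischargers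
    {ι : Type} {E : Functional (msCarriers ν n BgA BgB gauge gauge_nonneg transport) Bg}
    {W : Set (ℕ → ℝ)} {Adm : Set (Bg → (msCarriers ν n BgA BgB gauge gauge_nonneg transport).Dom → ℝ)}
    {T : ℕ → (ℕ → ℝ) → (Bg → (msCarriers ν n BgA BgB gauge gauge_nonneg transport).Dom → ℝ) → ι → ℝ}
    {Ψ : ℕ → ℝ → (ι → ℝ) → Bg → (msCarriers ν n BgA BgB gauge gauge_nonneg transport).Dom → ℝ}
    {μ : ℕ → ℝ → Bg → Finset (Site ν n) → Measure Ω} {pre : ℕ → ℝ → Bg → Finset (Site ν n) → Ω → ℂ}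
    {c : ℕ → ℝ → Bg → Finset (Site ν n) → Ω → F → ℂ}
    {pt : ℕ → ℝ → Bg → Finset (Site ν n) → Ω → F → Sp} {β : ℕ → Sp → ℝ}
    {dom : ℕ → Finset (Site ν n) → F → Finset (Site ν n)}
    {lip ε' α4 : ℕ → ℝ} {a₁ a'' κ lipbar ℓ τbar ω a a' : ℝ} {wt : ℕ → ι → ℝ} {τ : ℕ → ℕ → ℝ} {lam p₀ Nsz : ℕ → ℝ}
    (ρ : ℕ → (ι → ℝ) → (Sp →ᵇ ℂ))
    -- recursion side (displayed, named binders of the P2 leaves)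
    (h0 : ScaleZeroFree E W) (hAdm : AdmissibleTerms E W Adm) (hres : AdmRestrict Adm)
    (hadd : ChannelAdditive Adm T) (hsum : ChannelStepSum Adm T) (hstep : ChannelSizeAtStepNN Adm T κ wt τ)
    (hfac : Factorises E W T Ψ) (hlast : LastCouplingLipschitz E W T Ψ κ lam)
    (hρ : ∀ (k : ℕ) (P P' : ι → ℝ) (M : ℝ), (∀ y, |P y - P' y| ≤ wt k y * M) → ‖ρ k P - ρ k P'‖ ≤ M)
    (hΨ : ∀ (k : ℕ) (s : ℝ) (P P' : ι → ℝ) (U : Bg) (X : (msCarriers ν n BgA BgB gauge gauge_nonneg transport).Dom),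
      Ψ k s P U X - Ψ k s P' U X =
        ((msChart ν n BgA BgB gauge gauge_nonneg transport).geom.newTerm
            ((msChart ν n BgA BgB gauge gauge_nonneg transport).geom.avgExpLinearAct μ pre fun k s U γ ω =>
              evalFunctional (c k s U γ ω) (pt k s U γ ω)) k s U X (ρ k P) -
          (msChart ν n BgA BgB gauge gauge_nonneg transport).geom.newTerm
            ((msChart ν n BgA BgB gauge gauge_nonneg transport).geom.avgExpLinearAct μ pre fun k s U γ ω =>
              evalFunctional (c k s U γ ω) (pt k s U γ ω)) k s U X (ρ k P')).re)
    -- the size-induction data (B0), (X), (N) with B = a₁·e^{−a″(ν+1)}, (R′)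
    (hexpl : ∀ g ∈ W, ∀ (k : ℕ) (P : ι → ℝ) (U : Bg) (X : (msCarriers ν n BgA BgB gauge gauge_nonneg transport).Dom),
      (msCarriers ν n BgA BgB gauge gauge_nonneg transport).scale X = k + 1 →
      |Ψ k (g k) P U X -
          ((msChart ν n BgA BgB gauge gauge_nonneg transport).geom.newTerm
            ((msChart ν n BgA BgB gauge gauge_nonneg transport).geom.avgExpLinearAct μ pre fun k s U γ ω =>
              evalFunctional (c k s U γ ω) (pt k s U γ ω)) k (g k) U X (ρ k P)).re| ≤
        Real.exp (-(κ * (msCarriers ν n BgA BgB gauge gauge_nonneg transport).d X)) * p₀ k)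
    (hbase : ∀ g ∈ W, ∀ (U : Bg) (X : (msCarriers ν n BgA BgB gauge gauge_nonneg transport).Dom),
      (msCarriers ν n BgA BgB gauge gauge_nonneg transport).scale X = 0 →
      |E g U X| ≤ Real.exp (-(κ * (msCarriers ν n BgA BgB gauge gauge_nonneg transport).d X)) * Nsz 0)
    (hNsucc : ∀ j, p₀ j + a₁ * Real.exp (-(a'' * (ν + 1))) ≤ Nsz (j + 1)) (hNnn : ∀ j, 0 ≤ Nsz j)
    (hbox : ∀ (k : ℕ) (P : ι → ℝ), (∀ y, |P y| ≤ wt k y * sizeRadius τ Nsz k) → ∀ x, ‖ρ k P x‖ ≤ β k x)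
    -- activity side: regularity data, scales, ONE integrability, support of the coefficients
    (hpre : ∀ k s U γ, AEStronglyMeasurable (pre k s U γ) (μ k s U γ))
    (hc : ∀ k s U γ Y, AEStronglyMeasurable (fun ω => c k s U γ ω Y) (μ k s U γ))
    (hpt : ∀ k s U γ Y, Measurable fun ω => pt k s U γ ω Y) (hlip : ∀ k, 0 < lip k) (hlipb : ∀ k, lip k ≤ lipbar)
    (hint₀ : ∀ k s U γ, Integrable (fun ω => ‖pre k s U γ ω‖ * Real.exp (boxExponent c pt β k s U γ ω)) (μ k s U γ))
    (hmeet : ∀ k s U (γ : Finset (Site ν n)) ω Y, c k s U γ ω Y ≠ 0 → ∃ x ∈ γ, x ∈ dom k γ Y)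
    -- (L‴) decay of the coefficient tables in d_k + the pinned sums (1.26) in d_k on the sigma sites (§1 letters)
    (hα4 : ∀ k, 0 ≤ α4 k) (ha : (2:ℝ) ^ ν * Real.log 2 + Real.log (8 * ν) ≤ a)
    (hliplb : ∀ k, α4 k * 2 ^ (ν + 1 + 2 ^ ν) ≤ lip k)
    (hlin : ∀ k s U (γ : Finset (Site ν n)) ω Y,
      ‖c k s U γ ω Y‖ ≤ α4 k * Real.exp (-(a * (msLinSize (n := n) (dom k γ Y) : ℝ))))
    (hdomconn : ∀ k (γ : Finset (Site ν n)) Y, (dom k γ Y).Nonempty →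
      ∃ b ∈ dom k γ Y, Polymer.IsConn (SAdj ν n) (dom k γ Y) b)
    (hdominj : ∀ k (γ : Finset (Site ν n)), Set.InjOn (dom k γ) {Y | (dom k γ Y).Nonempty})
    -- (A″) decay of the box majorant in d_k (TYPE (2.38)) with the ADDITIVE rate condition and the smallness of part 4 §3
    (hε' : ∀ k, 0 ≤ ε' k)
    (hdecayLin : ∀ g ∈ W, ∀ (k : ℕ) (U : Bg) (X : (msCarriers ν n BgA BgB gauge gauge_nonneg transport).Dom),
      (msCarriers ν n BgA BgB gauge gauge_nonneg transport).scale X = k + 1 →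
      ∀ γ' ∈ (msChart ν n BgA BgB gauge gauge_nonneg transport).vol X,
        ∫ ω, ‖pre k (g k) U γ' ω‖ * Real.exp (boxExponent c pt β k (g k) U γ' ω) ∂(μ k (g k) U γ') ≤
          ε' k * Real.exp (-(a' * (msLinSize (n := n) γ' : ℝ))))
    (ha₁ : 0 ≤ a₁) (ha'' : 0 ≤ a'') (hκa : κ ≤ a'')
    (hrate : (2:ℝ) ^ ν * Real.log 2 + Real.log (8 * ν) ≤ a' - a'' - 2 ^ ν * (a₁ + Real.log 2))
    (hsmall : ∀ k, (((2 * ν : ℕ) : ℝ) + 1) * (2 * ε' k) * Real.exp (a'' * (ν + 1) + 2 ^ ν * (a₁ + Real.log 2)) *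
      2 ^ (ν + 1 + 2 ^ ν) ≤ a₁)
    -- envelope data
    (hℓ : 0 ≤ ℓ) (hτbar : 0 ≤ τbar) (hω : 0 ≤ ω) (hpos : 0 < ω + 4 * lipbar * (a₁ * Real.exp (-(a'' * (ν + 1)))) * τbar)
    (hlam : ∀ k, lam k ≤ ℓ) (hτ : ∀ k j, j ≤ k → 0 ≤ τ k j ∧ τ k j ≤ τbar * ω ^ (k - j)) :
    TermSize E W κ Nsz ∧
      NE9 E W κ (prodModuli ℓ fun _ => ω + 4 * lipbar * (a₁ * Real.exp (-(a'' * (ν + 1)))) * τbar) ∧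
        FadingMemory (ℓ / (ω + 4 * lipbar * (a₁ * Real.exp (-(a'' * (ν + 1)))) * τbar))
          (ω + 4 * lipbar * (a₁ * Real.exp (-(a'' * (ν + 1)))) * τbar)
          (prodModuli ℓ fun _ => ω + 4 * lipbar * (a₁ * Real.exp (-(a'' * (ν + 1)))) * τbar) := by
  -- (L′) from (L‴) in d_k on the sigma sites (§1)
  have hL : ∀ k s U (γ : Finset (Site ν n)) ω, coeffSum c k s U γ ω ≤ lip k * (γ.card : ℝ) :=
    coeffSum_le_of_pinned hmeet (pin_of_msLinSizeDecay hα4 ha hliplb hlin hdomconn hdominj)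
  -- the KP clause on the box majorant in d_k on the multi-scale chart (part 4 §3 ∘ E5′ §1)
  have hM0 : ∀ (k : ℕ) (s : ℝ) (U : Bg) (γ' : Finset (Site ν n)),
      0 ≤ 2 * ((1 + ((γ' : Finset (Site ν n)).card : ℝ)) *
        ∫ ω, ‖pre k s U γ' ω‖ * Real.exp (boxExponent c pt β k s U γ' ω) ∂(μ k s U γ')) := fun k s U γ' =>
    mul_nonneg (by norm_num) (mul_nonneg (by positivity)
      (integral_nonneg fun _ => mul_nonneg (norm_nonneg _) (Real.exp_pos _).le))
  have hkp := msChart_kpClause_of_linSizeDecay ν n BgA BgB gauge gauge_nonneg transport (W := W)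
    (M := fun k s U γ' => 2 * ((1 + ((γ' : Finset (Site ν n)).card : ℝ)) *
      ∫ ω, ‖pre k s U γ' ω‖ * Real.exp (boxExponent c pt β k s U γ' ω) ∂(μ k s U γ')))
    (ε := fun k => 2 * ε' k) (a₀ := Real.log 2) (fun k => by have := hε' k; positivity) hM0
    (fun g hg k U X hX γ' hγ' => two_mul_one_add_card_mul_le (hε' k) (hdecayLin g hg k U X hX γ' hγ'))
    ha₁ (Real.log_nonneg (by norm_num)) hrate hsmall
  have hB : 0 ≤ a₁ * Real.exp (-(a'' * (ν + 1))) := mul_nonneg ha₁ (Real.exp_nonneg _)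
  exact termSize_and_ne9_of_weightedClause (msChart ν n BgA BgB gauge gauge_nonneg transport) ρ h0 hAdm hres hadd hsum hstep
    hfac hlast hρ hΨ hexpl hbase hNsucc hNnn hbox hpre hc hpt hlip hlipb hint₀ hL
    ((msChart ν n BgA BgB gauge gauge_nonneg transport).supported.sizeWeight_nonneg ha₁)
    (fun γ => mul_nonneg ha'' (by positivity)) hkp
    (msChart_decayExtract_linSize ν n BgA BgB gauge gauge_nonneg transport ha'')
    (msChart_pinBudget_linSize ν n BgA BgB gauge gauge_nonneg transport ha₁ hκa) hB hℓ hτbar hω hpos hlam hτ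

/-! ## §3 The same face on road P2's own (A″) binder shape `fibreLinSize X.1 γ′` -/

/-- **E5′-ms ACCEPTING ROAD P2's (A″) BINDER ON THE MULTI-SCALE CHART VERBATIM (kernel).**  §2 with the box-majorant decay
displayed exactly as in `NE9MultiScaleChart.boxMajorantDecay_of_linSizeDecay_ms` (F3 §4): `≤ ε′ k·e^{−a′·fibreLinSize X.1 γ′}` — the
linear size read on the fibre of the DOMAIN's scale `X.1`; on the step volume of `X` this is `msLinSize γ′` (every step-volume polymer
is a nonempty one-scale family of scale `X.1`: `scale_of_mem_vol`, `msLinSize_eq`).  Every other binder and the conclusion those of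
§2.  So F3's cube-count reading of (A″) (`ε k = ε′ k·e^{a′}`, `y = e^{−a′/2^ν}`, rate divided by `2^ν` downstream) and this d_k reading
consume ONE displayed hypothesis. [cite: Balaban1988RG2Cluster, Lemma 3 (2.38) p.20, (2.30) p.18, (2.41) p.21; Balaban1987RG1, p.251 and p.257] -/
theorem msChart_termSize_ne9_and_fadingMemory_of_linSizeDischargers_fibre
    {ι : Type} {E : Functional (msCarriers ν n BgA BgB gauge gauge_nonneg transport) Bg}
    {W : Set (ℕ → ℝ)} {Adm : Set (Bg → (msCarriers ν n BgA BgB gauge gauge_nonneg transport).Dom → ℝ)}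
    {T : ℕ → (ℕ → ℝ) → (Bg → (msCarriers ν n BgA BgB gauge gauge_nonneg transport).Dom → ℝ) → ι → ℝ}
    {Ψ : ℕ → ℝ → (ι → ℝ) → Bg → (msCarriers ν n BgA BgB gauge gauge_nonneg transport).Dom → ℝ}
    {μ : ℕ → ℝ → Bg → Finset (Site ν n) → Measure Ω} {pre : ℕ → ℝ → Bg → Finset (Site ν n) → Ω → ℂ}
    {c : ℕ → ℝ → Bg → Finset (Site ν n) → Ω → F → ℂ}
    {pt : ℕ → ℝ → Bg → Finset (Site ν n) → Ω → F → Sp} {β : ℕ → Sp → ℝ}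
    {dom : ℕ → Finset (Site ν n) → F → Finset (Site ν n)}
    {lip ε' α4 : ℕ → ℝ} {a₁ a'' κ lipbar ℓ τbar ω a a' : ℝ} {wt : ℕ → ι → ℝ} {τ : ℕ → ℕ → ℝ} {lam p₀ Nsz : ℕ → ℝ}
    (ρ : ℕ → (ι → ℝ) → (Sp →ᵇ ℂ))
    (h0 : ScaleZeroFree E W) (hAdm : AdmissibleTerms E W Adm) (hres : AdmRestrict Adm)
    (hadd : ChannelAdditive Adm T) (hsum : ChannelStepSum Adm T) (hstep : ChannelSizeAtStepNN Adm T κ wt τ)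
    (hfac : Factorises E W T Ψ) (hlast : LastCouplingLipschitz E W T Ψ κ lam)
    (hρ : ∀ (k : ℕ) (P P' : ι → ℝ) (M : ℝ), (∀ y, |P y - P' y| ≤ wt k y * M) → ‖ρ k P - ρ k P'‖ ≤ M)
    (hΨ : ∀ (k : ℕ) (s : ℝ) (P P' : ι → ℝ) (U : Bg) (X : (msCarriers ν n BgA BgB gauge gauge_nonneg transport).Dom),
      Ψ k s P U X - Ψ k s P' U X =
        ((msChart ν n BgA BgB gauge gauge_nonneg transport).geom.newTerm
            ((msChart ν n BgA BgB gauge gauge_nonneg transport).geom.avgExpLinearAct μ pre fun k s U γ ω =>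
              evalFunctional (c k s U γ ω) (pt k s U γ ω)) k s U X (ρ k P) -
          (msChart ν n BgA BgB gauge gauge_nonneg transport).geom.newTerm
            ((msChart ν n BgA BgB gauge gauge_nonneg transport).geom.avgExpLinearAct μ pre fun k s U γ ω =>
              evalFunctional (c k s U γ ω) (pt k s U γ ω)) k s U X (ρ k P')).re)
    (hexpl : ∀ g ∈ W, ∀ (k : ℕ) (P : ι → ℝ) (U : Bg) (X : (msCarriers ν n BgA BgB gauge gauge_nonneg transport).Dom),
      (msCarriers ν n BgA BgB gauge gauge_nonneg transport).scale X = k + 1 →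
      |Ψ k (g k) P U X -
          ((msChart ν n BgA BgB gauge gauge_nonneg transport).geom.newTerm
            ((msChart ν n BgA BgB gauge gauge_nonneg transport).geom.avgExpLinearAct μ pre fun k s U γ ω =>
              evalFunctional (c k s U γ ω) (pt k s U γ ω)) k (g k) U X (ρ k P)).re| ≤
        Real.exp (-(κ * (msCarriers ν n BgA BgB gauge gauge_nonneg transport).d X)) * p₀ k)
    (hbase : ∀ g ∈ W, ∀ (U : Bg) (X : (msCarriers ν n BgA BgB gauge gauge_nonneg transport).Dom),
      (msCarriers ν n BgA BgB gauge gauge_nonneg transport).scale X = 0 →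
      |E g U X| ≤ Real.exp (-(κ * (msCarriers ν n BgA BgB gauge gauge_nonneg transport).d X)) * Nsz 0)
    (hNsucc : ∀ j, p₀ j + a₁ * Real.exp (-(a'' * (ν + 1))) ≤ Nsz (j + 1)) (hNnn : ∀ j, 0 ≤ Nsz j)
    (hbox : ∀ (k : ℕ) (P : ι → ℝ), (∀ y, |P y| ≤ wt k y * sizeRadius τ Nsz k) → ∀ x, ‖ρ k P x‖ ≤ β k x)
    (hpre : ∀ k s U γ, AEStronglyMeasurable (pre k s U γ) (μ k s U γ))
    (hc : ∀ k s U γ Y, AEStronglyMeasurable (fun ω => c k s U γ ω Y) (μ k s U γ))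
    (hpt : ∀ k s U γ Y, Measurable fun ω => pt k s U γ ω Y) (hlip : ∀ k, 0 < lip k) (hlipb : ∀ k, lip k ≤ lipbar)
    (hint₀ : ∀ k s U γ, Integrable (fun ω => ‖pre k s U γ ω‖ * Real.exp (boxExponent c pt β k s U γ ω)) (μ k s U γ))
    (hmeet : ∀ k s U (γ : Finset (Site ν n)) ω Y, c k s U γ ω Y ≠ 0 → ∃ x ∈ γ, x ∈ dom k γ Y)
    (hα4 : ∀ k, 0 ≤ α4 k) (ha : (2:ℝ) ^ ν * Real.log 2 + Real.log (8 * ν) ≤ a)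
    (hliplb : ∀ k, α4 k * 2 ^ (ν + 1 + 2 ^ ν) ≤ lip k)
    (hlin : ∀ k s U (γ : Finset (Site ν n)) ω Y,
      ‖c k s U γ ω Y‖ ≤ α4 k * Real.exp (-(a * (msLinSize (n := n) (dom k γ Y) : ℝ))))
    (hdomconn : ∀ k (γ : Finset (Site ν n)) Y, (dom k γ Y).Nonempty →
      ∃ b ∈ dom k γ Y, Polymer.IsConn (SAdj ν n) (dom k γ Y) b)
    (hdominj : ∀ k (γ : Finset (Site ν n)), Set.InjOn (dom k γ) {Y | (dom k γ Y).Nonempty})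
    -- (A″) in F3 §4's shape: the linear size read on the fibre of the DOMAIN's scale
    (hε' : ∀ k, 0 ≤ ε' k)
    (hdecayFib : ∀ g ∈ W, ∀ (k : ℕ) (U : Bg) (X : (msCarriers ν n BgA BgB gauge gauge_nonneg transport).Dom),
      (msCarriers ν n BgA BgB gauge gauge_nonneg transport).scale X = k + 1 →
      ∀ γ' ∈ (msChart ν n BgA BgB gauge gauge_nonneg transport).vol X,
        ∫ ω, ‖pre k (g k) U γ' ω‖ * Real.exp (boxExponent c pt β k (g k) U γ' ω) ∂(μ k (g k) U γ') ≤
          ε' k * Real.exp (-(a' * (fibreLinSize X.1 γ' : ℝ))))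
    (ha₁ : 0 ≤ a₁) (ha'' : 0 ≤ a'') (hκa : κ ≤ a'')
    (hrate : (2:ℝ) ^ ν * Real.log 2 + Real.log (8 * ν) ≤ a' - a'' - 2 ^ ν * (a₁ + Real.log 2))
    (hsmall : ∀ k, (((2 * ν : ℕ) : ℝ) + 1) * (2 * ε' k) * Real.exp (a'' * (ν + 1) + 2 ^ ν * (a₁ + Real.log 2)) *
      2 ^ (ν + 1 + 2 ^ ν) ≤ a₁)
    (hℓ : 0 ≤ ℓ) (hτbar : 0 ≤ τbar) (hω : 0 ≤ ω) (hpos : 0 < ω + 4 * lipbar * (a₁ * Real.exp (-(a'' * (ν + 1)))) * τbar)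
    (hlam : ∀ k, lam k ≤ ℓ) (hτ : ∀ k j, j ≤ k → 0 ≤ τ k j ∧ τ k j ≤ τbar * ω ^ (k - j)) :
    TermSize E W κ Nsz ∧
      NE9 E W κ (prodModuli ℓ fun _ => ω + 4 * lipbar * (a₁ * Real.exp (-(a'' * (ν + 1)))) * τbar) ∧
        FadingMemory (ℓ / (ω + 4 * lipbar * (a₁ * Real.exp (-(a'' * (ν + 1)))) * τbar))
          (ω + 4 * lipbar * (a₁ * Real.exp (-(a'' * (ν + 1)))) * τbar)
          (prodModuli ℓ fun _ => ω + 4 * lipbar * (a₁ * Real.exp (-(a'' * (ν + 1)))) * τbar) :=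
  msChart_termSize_ne9_and_fadingMemory_of_linSizeDischargers ν n BgA BgB gauge gauge_nonneg transport ρ h0 hAdm hres hadd hsum
    hstep hfac hlast hρ hΨ hexpl hbase hNsucc hNnn hbox hpre hc hpt hlip hlipb hint₀ hmeet hα4 ha hliplb hlin hdomconn hdominj hε'
    (fun g hg k U X hX γ' hγ' => by
      rw [msLinSize_eq (scale_of_mem_vol ν n BgA BgB gauge gauge_nonneg transport X hγ') (nonempty_of_mem_connFamilies hγ')]
      exact hdecayFib g hg k U X hX γ' hγ')
    ha₁ ha'' hκa hrate hsmall hℓ hτbar hω hpos hlam hτ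

end Chart

end Summit.QuantumFields.BalabanUV.T4Continuum.NE9LinSizeEndMultiScale

end
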